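import Literature.MathematicalPhysics.QuantumFieldTheory.Balaban1983to89.B9SectBKerFrameV3
import Literature.MathematicalPhysics.QuantumFieldTheory.Balaban1983to89.B9Thm34GUniformBlk
import Literature.MathematicalPhysics.QuantumFieldTheory.Balaban1983to89.B9SectBGStepAtLetters

/-!
# Balaban [B9], Thm 3.4 p. 400 with Thm 3.3 p. 399, (3.84)–(3.86) p. 407 — the (3.42)-, (3.47)- and analytic-extension steps for the BOND-SECTOR
# operator G(U′U) PINNED AT THE LETTERS, FRAMES V3: `GFrame₃` (= V2 `B9SectBGStepAtLettersV2.GFrame₂` re-typed to extend the BLOCK-CARRIER C⁻¹ frame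
# `B9SectBKerFrameV3.CinvFrame₃`), ★ `entries342_ext_of_gFrame₃`, ★ `stepEPos_of_gFrame₃`, `GlobGFrame₃` ∕ ★ `stepGlobPos_of_globGFrame₃`,
# `AnGFrame₃` ∕ ★ `stepAnalyticPos1_of_anGFrame₃` — on r06's block-carrier G-clause `B9Thm34GUniformBlk.thm34_G_clause_uniform_blk` (R-Ker-2)

T. Bałaban, *Propagators for lattice gauge theories in a background field*, Commun. Math. Phys. **99** (1985) 389–434
[`Balaban1985BackgroundPropagators`, "B9"]; [4] = T. Bałaban, *Propagators and renormalization transformations for lattice gauge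
theories. II*, Commun. Math. Phys. **96** (1984) 223–250 [`Balaban1984PropagatorsII`].

statement-level skeleton of published theorems with citation tags; proofs where landed; nothing here is a claim about the
Yang–Mills mass gap

WHY A V3 (LOCATED-10 of the pub-ymgap N06 bus: the V2 frames type the C⁻¹ letters on the SCALAR block functions `(geo i).Site → ℝ`, one real unknown per
block, whereas print's `C(U) = Q′G′²Q′*` acts on 𝔤-valued block functions; r06's repair R-Ker-2 = the block-carrier clauses).  V2's `GFrame₂` extends
`CinvFrame₂`; THIS FILE is the same dictionary extending `CinvFrame₃ … P Cinv` (block carrier `P i` with block map `blkP i`, Hom letters `Qc ∕ Qcs` between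
`S i × ι` and `P i`, `Cop i V : End(P i → ℝ)`), with the section `rep i : P i → S i × ι` now block-COMPATIBLE (`blk (rep p).1 = blkP p`) and INJECTIVE as fields
(`hrep`, `hinj` — exactly the binders of `thm34_G_clause_uniform_blk`), the `R(V)` word `1 − G′Q′*C⁻¹Q′G′` of the concrete `Δ_a(V)` typed through them, and the
proof of the (3.42)-entries theorem re-threaded on `thm34_G_clause_uniform_blk`: the (3.48) input enters as the block majorant `readKer` delivers (no [4]-(2.61)
exponent change), everything else VERBATIM as V2 (`thm34_Gp_uniform` R1 for the G′ extension's inverse identities; the three uniqueness identifications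
`gop_eq`, `cop_eq`, `gb_eq`; the section identity `B9SectBGStepAtLetters.rZero_add_pPrime_sections`; `coord_mul`).

HONEST SCOPE.  Nothing of print is asserted and no operator of [B9] is constructed: `GFrame₃` is a hypothesis structure (the contract an instance meets — for
node00-def-Y's bond letters and the coded bond readings `KACU`, the next units of dag-n06-c — there the section is `B9SectBKerLettersY.repY` (corner site; `blkC_repY`,
`repY_injective`, v1.1) over `B9SectBKerFrameCodedY.cinvFrame₃CodedOn`), NOT shown inhabited here; r06's theorems USED BY NAME.
Count-neutral; NOT a node discharge; nothing continuum ∕ OS ∕ mass-gap ∕ Clay.  Seat dag-n06-c g12, 2026-08-28; `--supports stmt-QuantumFields-27364`.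
-/

noncomputable section

namespace Literature.MathematicalPhysics.QuantumFieldTheory.Balaban1983to89.B9SectBGFrameV3

open Literature.MathematicalPhysics.QuantumFieldTheory.Balaban1983to89
open Literature.MathematicalPhysics.QuantumFieldTheory.Balaban1983to89.B6RandomWalk (HasMajorant hasMajorant_mono Triangle254 Ineq261)
open Literature.MathematicalPhysics.QuantumFieldTheory.Balaban1983to89.B6RandomWalkHom (HasMajorantHom)
open Literature.MathematicalPhysics.QuantumFieldTheory.Balaban1983to89.B6RandomWalkSection (secExt secRes secConj secConj_def
  secRes_comp_secExt)
open Literature.MathematicalPhysics.QuantumFieldTheory.Balaban1983to89.B9Thm34Ext (toB6)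
open Literature.MathematicalPhysics.QuantumFieldTheory.Balaban1983to89.B9Ineq347 (ScaleTransfer)
open Literature.MathematicalPhysics.QuantumFieldTheory.Balaban1983to89.B9Eq39Adjoint (covD covDstar prodCfg plaqU)
open Literature.MathematicalPhysics.QuantumFieldTheory.Balaban1983to89.B9Eq369Small (Through)
open Literature.MathematicalPhysics.QuantumFieldTheory.Balaban1983to89.B9Eq372Locality (stBonds)
open Literature.MathematicalPhysics.QuantumFieldTheory.Balaban1983to89.B9Eq352DivForm (tauF tauB)
open Literature.MathematicalPhysics.QuantumFieldTheory.Balaban1983to89.B9Eq352DivFormLetters (conj)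
open Literature.MathematicalPhysics.QuantumFieldTheory.Balaban1983to89.B9Eq352GradLetters (diffLetter)
open Literature.MathematicalPhysics.QuantumFieldTheory.Balaban1983to89.B9Eq371GradLetters (bT bU)
open Literature.MathematicalPhysics.QuantumFieldTheory.Balaban1983to89.B9Eq372RemLetters (lapDDLetter)
open Literature.MathematicalPhysics.QuantumFieldTheory.Balaban1983to89.B9Eq382V3Letters (dPrimeLetter)
open Literature.MathematicalPhysics.QuantumFieldTheory.Balaban1983to89.B9Eq376POneLetters (conjHom gradLin divLin)
open Literature.MathematicalPhysics.QuantumFieldTheory.Balaban1983to89.B9Eq386Neumann (pTwo deltaA)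
open Literature.MathematicalPhysics.QuantumFieldTheory.Balaban1983to89.B9Eq360Vprime (gPrimeExtEnd pPrime pOp)
open Literature.MathematicalPhysics.QuantumFieldTheory.Balaban1983to89.B9Eq360VprimeLetters (vPrimeConc)
open Literature.MathematicalPhysics.QuantumFieldTheory.Balaban1983to89.B9Thm34SectBUniformR1 (thm34_Gp_uniform)
open Literature.MathematicalPhysics.QuantumFieldTheory.Balaban1983to89.B9Thm34GUniformBlk (thm34_G_clause_uniform_blk)
open Literature.MathematicalPhysics.QuantumFieldTheory.Balaban1983to89.B9FromB6 (EBlock)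
open Literature.MathematicalPhysics.QuantumFieldTheory.Balaban1983to89.B9SectBStepWhole (StepPos StepEPos)
open Literature.MathematicalPhysics.QuantumFieldTheory.Balaban1983to89.B9SectBGpStepAtLettersV2 (GpFrame₂)
open Literature.MathematicalPhysics.QuantumFieldTheory.Balaban1983to89.B9SectBKerFrameV3 (CinvFrame₃)
open Literature.MathematicalPhysics.QuantumFieldTheory.Balaban1983to89.B9SectBGStepAtLetters (rZero_add_pPrime_sections)

universe u

variable {I : Type} (d : ℕ) (c35 : ℝ) (geo : I → B9.Geometry) (bg : I → B9.Backgrounds)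
  (Gp : ∀ i, B9.KernelFamily (geo i) (bg i))
  {𝔸 : Type u} [NormedRing 𝔸] [NormedAlgebra ℂ 𝔸] [CompleteSpace 𝔸] {ι : Type} [Fintype ι] [DecidableEq ι]
  (b : Module.Basis ι ℝ 𝔸) (κ : Type) [Fintype κ] [LinearOrder κ]
  (S : I → Type) [∀ i, Fintype (S i)] [∀ i, DecidableEq (S i)]
  [∀ i, Fintype (geo i).Site] [∀ i, DecidableEq (geo i).Site] [∀ i, Nonempty (geo i).Site]
  (P : I → Type) [∀ i, Fintype (P i)] [∀ i, DecidableEq (P i)]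

/-- Rate bookkeeping for block majorants: a majorant `c·P(a)·e^{−δd}` with `c·P ≧ 0` stays one at any smaller rate `δ′ ≦ δ`
(d ≧ 0). [folklore] [cite: Balaban1984PropagatorsII, (2.51) p.232] -/
private theorem hasMajorant_rate_le {g : B6.Geometry} {X : Type} (blk : X → g.Site) {T : Module.End ℝ (X → ℝ)}
    {c δ δ' : ℝ} (P : g.Site → ℝ) (hc : ∀ a, 0 ≤ c * P a) (hδ : δ' ≤ δ) (hd : ∀ a a' : g.Site, 0 ≤ g.dist a a')
    (h : HasMajorant blk T (fun a a' => c * P a * Real.exp (-(δ * g.dist a a')))) :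
    HasMajorant blk T (fun a a' => c * P a * Real.exp (-(δ' * g.dist a a'))) :=
  hasMajorant_mono blk h fun a a' =>
    mul_le_mul_of_nonneg_left (Real.exp_le_exp.2 (by nlinarith [hd a a', hδ])) (hc a)

/-! ## The letters dictionary for the bond-sector family G -/

/-- **THE LETTERS DICTIONARY FOR THE G FAMILY** (Theorem 3.3's bond-sector operator `G(U) = Δ_a(U)⁻¹` (3.30), the `GA` family of
the N06 record) — `CinvFrame₃` (V3: the site-sector letters of G′ and the BLOCK-CARRIER letters of C⁻¹ with their laws; the rate cap `δcap` and the
M-thresholded Lemma-2.1 fields as in V2) extended by EXACTLY the further hypotheses of r06's uniform G-clause `B9Thm34GUniformR1.thm34_G_clause_uniform` per member `i`: commuting shifts (`T_comm`), `1 ≦ L`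
(`L_one_le`), the (3.35) plaquette reading at the bond's block scale with a frame-level constant `C₀` above the thresholds
(`reg335`), the extra stencils (`stencilFB`, `stencilSt`, `stencilLoc`), an injective block-compatible section `rep i : P i → S i × ι` of the block carrier (`hrep`, `hinj` —
FILE 17 of r06, the binders of `thm34_G_clause_uniform_blk`), the bond letters `Gb i V` = G(V) (3.27)∕(3.30), `Qb i V` = Q(V), `Qsb i V` = Q*(V) (3.15), the weight letter `ab i` = a of
(3.24)∕(3.26) (`ha324`), the (3.80)–(3.81) variations `F₂ i U U′`, `F₂s i U U′`, the bond Laplacian letter `LapB i U` (fourth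
(3.42) entry); the frame-level constants `C₀ κQb cFb abar`, the reading constant `cRG`, the writing
functions `wBG wδG`; and the LAWS: `gb_eq` (G(V) is THE two-sided inverse of the concrete Δ_a(V) of (3.30)∕(3.82)–(3.84) —
r06's `deltaA` word in the letters at V with R(V) by the algebraic (3.25) — whenever one exists), `reg_ginv` (one exists at
(3.35)-regular U above the thresholds, Thm 3.3 ∕ 3.11), `coord_mul` (the background of U′U on the class (3.37) is
`prodCfg U η A`), `qb_mul` ((3.80)), `hQb`∕`hQsb`∕`hF₂` (block-majorant sizes of the bond letters at every rate `δ ≦ δcap`),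
`cplxG` (the seven further blockwise (3.37) readings), `readG342` ∕ `writeG342` (the (3.42) block of `GA` ↔ block majorants of the
bond letters, both ways).  Field shapes = the hypotheses of `thm34_G_clause_uniform_blk` verbatim (block-majorant letters only; NO kernel-form
letter of G(U) — those enter r06's chain only above `B9Thm34GKernelUniform`, not used here).  A hypothesis structure; nothing asserted. [cite: Balaban1985BackgroundPropagators, Thm 3.4 p.400 + Thm 3.3 p.399 + (3.15) p.393 + (3.24)–(3.27) p.394 + (3.30) p.395 + (3.35)/(3.37) p.396 + Thm 3.1 (3.42) p.397 + (3.68) p.403 + (3.80)–(3.86) p.407 + Thm 3.11 p.416; Balaban1984PropagatorsII, (2.51) p.232 + Lemma 2.1 p.234] -/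
structure GFrame₃ (GA : ∀ i, B9.KernelFamily (geo i) (bg i)) (Cinv : ∀ i, B9.SiteKernel (geo i) (bg i))
    extends CinvFrame₃ c35 geo bg Gp b κ S P Cinv where
  /-- (3.35) plaquette constant, (3.15) bond-letter size, (3.80)–(3.81) size, the weight bound ā of (3.24), reading constant and
  writing functions for the G family (the rate cap `δcap` is the parent's, v2). -/
  C₀ : ℝ
  κQb : ℝ
  cFb : ℝ
  abar : ℝ
  cRG : ℝ
  wBG : ℝ → ℝ → ℝ
  wδG : ℝ → ℝ
  C₀_nonneg : 0 ≤ C₀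
  κQb_nonneg : 0 ≤ κQb
  cFb_nonneg : 0 ≤ cFb
  abar_nonneg : 0 ≤ abar
  cRG_pos : 0 < cRG
  wBG_pos : ∀ B δ : ℝ, 0 ≤ B → 0 < δ → 0 < wBG B δ
  wδG_pos : ∀ δ : ℝ, 0 < δ → 0 < wδG δ
  /-- per member: the section of the block map, the bond letters. -/
  rep : ∀ i, P i → S i × ι
  Gb : ∀ i, (bg i).Cfg → Module.End ℝ ((κ × S i) × ι → ℝ)
  Qb : ∀ i, (bg i).Cfg → Module.End ℝ ((κ × S i) × ι → ℝ)
  Qsb : ∀ i, (bg i).Cfg → Module.End ℝ ((κ × S i) × ι → ℝ)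
  ab : ∀ i, Module.End ℝ ((κ × S i) × ι → ℝ)
  F₂ : ∀ i, (bg i).Cfg → (bg i).Cfg → Module.End ℝ ((κ × S i) × ι → ℝ)
  F₂s : ∀ i, (bg i).Cfg → (bg i).Cfg → Module.End ℝ ((κ × S i) × ι → ℝ)
  LapB : ∀ i, (bg i).Cfg → Module.End ℝ ((κ × S i) × ι → ℝ)
  /-- `L ≧ 1`, commuting shifts, the block-compatible injective section `rep` of the block carrier into the site carrier. -/
  L_one_le : ∀ i, 1 ≤ (geo i).L
  T_comm : ∀ i (μ ν : κ) (x : S i), T i μ (T i ν x) = T i ν (T i μ x)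
  hrep : ∀ i (p : P i), blk i (rep i p).1 = blkP i p
  hinj : ∀ i, Function.Injective (rep i)
  /-- the three further stencils of r06's G-clause at range `d₀`. -/
  stencilFB : ∀ i (μ ν : κ) (x : S i), (geo i).dist (blk i x) (blk i ((T i ν).symm (T i μ x))) ≤ d₀
  stencilSt : ∀ i (μ : κ) (x : S i) (q : κ × S i), q ∈ stBonds (T i) μ x → (geo i).dist (blk i x) (blk i q.2) ≤ d₀
  stencilLoc : ∀ i (μ : κ) (x : S i) (q : κ × S i), q ∈ B9Eq375Locality.locBondsA' (T i) μ x →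
    (geo i).dist (blk i x) (blk i q.2) ≤ d₀
  /-- LAW (3.35) READ ON PLAQUETTES: at a (3.35)-regular U above the thresholds, every plaquette through a bond is within
  `C₀·(L^{j})^{−2}` of 1 at that bond's block scale (frame-level `C₀`, since `Mα₀ ≦ aInv`). -/
  reg335 : ∀ i (α₀ : ℝ) (U : (bg i).Cfg), MInv ≤ (geo i).M → 0 < α₀ → (geo i).M * α₀ ≤ aInv → (bg i).Reg335 c35 α₀ U →
    ∀ (μ : κ) (x : S i) (m n : κ) (y : S i), Through (T i) μ x m n y →
      ‖(plaqU (T i) (coord i U) m n y : 𝔸) - 1‖ ≤ C₀ * (((geo i).L ^ (geo i).scale (blk i x))⁻¹) ^ 2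
  /-- (3.15): Q(V), Q*(V) have block majorants `κQb·e^{−δd}` at every rate `0 < δ ≦ δcap` (block-local letters). -/
  hQb : ∀ i (V : (bg i).Cfg) (δ : ℝ), 0 < δ → δ ≤ δcap →
    HasMajorant (g := toB6 (geo i) (Rr i) (Hp i)) (fun q : (κ × S i) × ι => blk i q.1.2) (Qb i V)
      (fun a a' => κQb * Real.exp (-(δ * (geo i).dist a a')))
  hQsb : ∀ i (V : (bg i).Cfg) (δ : ℝ), 0 < δ → δ ≤ δcap →
    HasMajorant (g := toB6 (geo i) (Rr i) (Hp i)) (fun q : (κ × S i) × ι => blk i q.1.2) (Qsb i V)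
      (fun a a' => κQb * Real.exp (-(δ * (geo i).dist a a')))
  /-- (3.24)∕(3.26): the weight letter `a` is block-diagonal with entries `≦ ā·(Lʲη)^{−2}`. -/
  ha324 : ∀ i, HasMajorant (g := toB6 (geo i) (Rr i) (Hp i)) (fun q : (κ × S i) × ι => blk i q.1.2) (ab i)
    (fun a a' : (geo i).Site => if a = a' then abar * ((geo i).len a ^ 2)⁻¹ else 0)
  /-- `G(V)` is THE two-sided inverse of the concrete `Δ_a(V)` (r06's `deltaA` word in the letters at V, R(V) by (3.25))
  whenever one exists (every configuration, complex ones included). -/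
  gb_eq : ∀ i (V : (bg i).Cfg) (D X : Module.End ℝ ((κ × S i) × ι → ℝ)),
    deltaA (conj b (lapDDLetter (T i) ((((geo i).eta : ℂ))⁻¹) (coord i V))) (conj b (dPrimeLetter (T i) (coord i V) (geo i).eta))
        (conjHom b (gradLin (T i) ((((geo i).eta : ℂ))⁻¹) (coord i V)) ∘ₗ
            (1 - (Gop i V ∘ₗ Qcs i V ∘ₗ Cop i V ∘ₗ Qc i V ∘ₗ Gop i V)) ∘ₗ
          conjHom b (divLin (T i) ((((geo i).eta : ℂ))⁻¹) (coord i V))) (Qsb i V) (ab i) (Qb i V) = D →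
    D * X = 1 → X * D = 1 → Gb i V = X
  /-- Theorem 3.3 ∕ 3.11: at a (3.35)-regular U above the thresholds, the concrete Δ_a(U) is inverted by G(U). -/
  reg_ginv : ∀ i (α₀ : ℝ) (U : (bg i).Cfg), MInv ≤ (geo i).M → 0 < α₀ → (geo i).M * α₀ ≤ aInv → (bg i).Reg335 c35 α₀ U →
    deltaA (conj b (lapDDLetter (T i) ((((geo i).eta : ℂ))⁻¹) (coord i U))) (conj b (dPrimeLetter (T i) (coord i U) (geo i).eta))
        (conjHom b (gradLin (T i) ((((geo i).eta : ℂ))⁻¹) (coord i U)) ∘ₗ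
            (1 - (Gop i U ∘ₗ Qcs i U ∘ₗ Cop i U ∘ₗ Qc i U ∘ₗ Gop i U)) ∘ₗ
          conjHom b (divLin (T i) ((((geo i).eta : ℂ))⁻¹) (coord i U))) (Qsb i U) (ab i) (Qb i U) * Gb i U = 1 ∧
    Gb i U * deltaA (conj b (lapDDLetter (T i) ((((geo i).eta : ℂ))⁻¹) (coord i U)))
        (conj b (dPrimeLetter (T i) (coord i U) (geo i).eta))
        (conjHom b (gradLin (T i) ((((geo i).eta : ℂ))⁻¹) (coord i U)) ∘ₗ
            (1 - (Gop i U ∘ₗ Qcs i U ∘ₗ Cop i U ∘ₗ Qc i U ∘ₗ Gop i U)) ∘ₗ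
          conjHom b (divLin (T i) ((((geo i).eta : ℂ))⁻¹) (coord i U))) (Qsb i U) (ab i) (Qb i U) = 1
  /-- on the class (3.37): U′ = e^{iηA} with A = `expA i U U′`, so the lattice field of U′U is `prodCfg U η A`. -/
  coord_mul : ∀ i (α₁ : ℝ) (U U' : (bg i).Cfg), 0 < α₁ → (bg i).Cplx337 α₁ U U' →
    coord i ((bg i).mul U' U) = prodCfg (coord i U) (geo i).eta (expA i U U')
  /-- (3.80): Q(U′U) = Q(U) + F₂(A), Q*(U′U) = Q*(U) + F₂*(A) on the class (3.37). -/
  qb_mul : ∀ i (α₁ : ℝ) (U U' : (bg i).Cfg), 0 < α₁ → (bg i).Cplx337 α₁ U U' →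
    Qb i ((bg i).mul U' U) = Qb i U + F₂ i U U' ∧ Qsb i ((bg i).mul U' U) = Qsb i U + F₂s i U U'
  /-- (3.81): `|F₂(A)|, |F₂*(A)| ≦ O(1)α₁` as block majorants `cFb·α₁·e^{−δd}` at every rate `0 < δ ≦ δcap`. -/
  hF₂ : ∀ i (α₁ : ℝ) (U U' : (bg i).Cfg), 0 < α₁ → (bg i).Cplx337 α₁ U U' → ∀ δ : ℝ, 0 < δ → δ ≤ δcap →
    HasMajorant (g := toB6 (geo i) (Rr i) (Hp i)) (fun q : (κ × S i) × ι => blk i q.1.2) (F₂ i U U')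
        (fun a a' => cFb * α₁ * Real.exp (-(δ * (geo i).dist a a'))) ∧
      HasMajorant (g := toB6 (geo i) (Rr i) (Hp i)) (fun q : (κ × S i) × ι => blk i q.1.2) (F₂s i U U')
        (fun a a' => cFb * α₁ * Real.exp (-(δ * (geo i).dist a a')))
  /-- the class (3.37) read blockwise: the seven FURTHER bounds of `thm34_G_clause_uniform` (beyond `cplx`). -/
  cplxG : ∀ i (α₁ : ℝ) (U U' : (bg i).Cfg), 0 < α₁ → (bg i).Cplx337 α₁ U U' →
    (∀ (μ ν : κ) (x : S i), ‖(((geo i).eta : ℂ))⁻¹ • covDstar (T i) (coord i U) ν (expA i U U' ν) (T i μ x)‖ ≤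
      α₁ * ((geo i).len (blk i x) ^ 2)⁻¹) ∧
    (∀ (μ ν k : κ) (x : S i), ‖(((geo i).eta : ℂ))⁻¹ • covD (T i) (coord i U) μ (expA i U U' k) ((T i ν).symm x)‖ ≤
      α₁ * ((geo i).len (blk i x) ^ 2)⁻¹) ∧
    (∀ (μ k : κ) (x : S i), ‖tauF (T i) (coord i U) μ (expA i U U' k) x‖ ≤ α₁ * ((geo i).len (blk i x))⁻¹) ∧
    (∀ (k μ ν : κ) (x : S i), ‖expA i U U' k ((T i ν).symm (T i μ x))‖ ≤ α₁ * ((geo i).len (blk i x))⁻¹) ∧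
    (∀ (μ : κ) (x : S i) (m : κ) (z : S i), (m, z) ∈ stBonds (T i) μ x → ‖expA i U U' m z‖ ≤ α₁ * ((geo i).len (blk i x))⁻¹) ∧
    (∀ (μ : κ) (x : S i) (m : κ) (z : S i), (m, z) ∈ B9Eq375Locality.locBondsA (T i) μ x →
      ‖expA i U U' m z‖ ≤ α₁ * ((geo i).len (blk i x))⁻¹) ∧
    (∀ (μ : κ) (x : S i) (m n : κ) (y : S i), Through (T i) μ x m n y →
      ‖covD (T i) (coord i U) m (expA i U U' n) y‖ ≤ (geo i).eta * (α₁ * (((geo i).len (blk i x))⁻¹) ^ 2) ∧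
        ‖covD (T i) (coord i U) n (expA i U U' m) y‖ ≤ (geo i).eta * (α₁ * (((geo i).len (blk i x))⁻¹) ^ 2))
  /-- READING: the (3.42) block of `GA` at U with (B₀, δ) ⇒ block majorants of the four bond letters of G(U) with (cRG·B₀, δ). -/
  readG342 : ∀ i (α₀ : ℝ) (U : (bg i).Cfg) (B₀ δ : ℝ), MInv ≤ (geo i).M → 0 < α₀ → (geo i).M * α₀ ≤ aInv →
    (bg i).Reg335 c35 α₀ U → 0 < B₀ → 0 < δ → EBlock (GA i) B₀ δ U →
    HasMajorant (g := toB6 (geo i) (Rr i) (Hp i)) (fun q : (κ × S i) × ι => blk i q.1.2) (Gb i U)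
        (fun a a' => cRG * B₀ * (geo i).len a ^ 2 * Real.exp (-(δ * (geo i).dist a a'))) ∧
      (∀ k : κ ⊕ κ, HasMajorant (g := toB6 (geo i) (Rr i) (Hp i)) (fun q : (κ × S i) × ι => blk i q.1.2)
        (conj b (diffLetter (bT (T i)) (bU (coord i U)) ((((geo i).eta : ℂ))⁻¹) k) * Gb i U)
        (fun a a' => cRG * B₀ * (geo i).len a * Real.exp (-(δ * (geo i).dist a a')))) ∧
      (∀ k : κ ⊕ κ, HasMajorant (g := toB6 (geo i) (Rr i) (Hp i)) (fun q : (κ × S i) × ι => blk i q.1.2)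
        (Gb i U * conj b (diffLetter (bT (T i)) (bU (coord i U)) ((((geo i).eta : ℂ))⁻¹) k))
        (fun a a' => cRG * B₀ * (geo i).len a * Real.exp (-(δ * (geo i).dist a a')))) ∧
      HasMajorant (g := toB6 (geo i) (Rr i) (Hp i)) (fun q : (κ × S i) × ι => blk i q.1.2) (LapB i U * Gb i U)
        (fun a a' => cRG * B₀ * 1 * Real.exp (-(δ * (geo i).dist a a')))
  /-- WRITING: block majorants of the four bond letters of G(U′U) (letters ∇_{U,k}, Δ_U at the real U) with (B, δ) ⇒ the (3.42)
  block of `GA` at U′U with (wBG B δ, wδG δ), for U′ in the class (3.37) at α₁ ≦ aW. -/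
  writeG342 : ∀ i (U U' : (bg i).Cfg) (α₁ B δ : ℝ), 0 < α₁ → α₁ ≤ aW → (bg i).Cplx337 α₁ U U' → 0 ≤ B → 0 < δ →
    HasMajorant (g := toB6 (geo i) (Rr i) (Hp i)) (fun q : (κ × S i) × ι => blk i q.1.2) (Gb i ((bg i).mul U' U))
        (fun a a' => B * (geo i).len a ^ 2 * Real.exp (-(δ * (geo i).dist a a'))) →
    (∀ k : κ ⊕ κ, HasMajorant (g := toB6 (geo i) (Rr i) (Hp i)) (fun q : (κ × S i) × ι => blk i q.1.2)
        (conj b (diffLetter (bT (T i)) (bU (coord i U)) ((((geo i).eta : ℂ))⁻¹) k) * Gb i ((bg i).mul U' U))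
        (fun a a' => B * (geo i).len a * Real.exp (-(δ * (geo i).dist a a')))) →
    (∀ k : κ ⊕ κ, HasMajorant (g := toB6 (geo i) (Rr i) (Hp i)) (fun q : (κ × S i) × ι => blk i q.1.2)
        (Gb i ((bg i).mul U' U) * conj b (diffLetter (bT (T i)) (bU (coord i U)) ((((geo i).eta : ℂ))⁻¹) k))
        (fun a a' => B * (geo i).len a * Real.exp (-(δ * (geo i).dist a a')))) →
    HasMajorant (g := toB6 (geo i) (Rr i) (Hp i)) (fun q : (κ × S i) × ι => blk i q.1.2)
        (LapB i U * Gb i ((bg i).mul U' U)) (fun a a' => B * 1 * Real.exp (-(δ * (geo i).dist a a'))) →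
    EBlock (GA i) (wBG B δ) (wδG δ) ((bg i).mul U' U)

variable {d c35 geo bg Gp b κ S P}

/-- The frame's concrete `Δ_a(V)` word ((3.30) ∕ (3.82)–(3.84) in r06's letters at V, with R(V) by the algebraic (3.25)):
the `D` of the laws `gb_eq` ∕ `reg_ginv`. [cite: Balaban1985BackgroundPropagators, (3.30) p.395 + (3.25) p.394 + (3.82)–(3.84) p.407] -/
def GFrame₃.DeltaA {GA : ∀ i, B9.KernelFamily (geo i) (bg i)} {Cinv : ∀ i, B9.SiteKernel (geo i) (bg i)}
    (F : GFrame₃ c35 geo bg Gp b κ S P GA Cinv) (i : I) (V : (bg i).Cfg) : Module.End ℝ ((κ × S i) × ι → ℝ) :=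
  deltaA (conj b (lapDDLetter (F.T i) ((((geo i).eta : ℂ))⁻¹) (F.coord i V)))
    (conj b (dPrimeLetter (F.T i) (F.coord i V) (geo i).eta))
    (conjHom b (gradLin (F.T i) ((((geo i).eta : ℂ))⁻¹) (F.coord i V)) ∘ₗ
        (1 - (F.Gop i V ∘ₗ F.Qcs i V ∘ₗ F.Cop i V ∘ₗ F.Qc i V ∘ₗ F.Gop i V)) ∘ₗ
      conjHom b (divLin (F.T i) ((((geo i).eta : ℂ))⁻¹) (F.coord i V))) (F.Qsb i V) (F.ab i) (F.Qb i V)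

omit [DecidableEq ι] [∀ i, DecidableEq (S i)] [∀ i, Nonempty (geo i).Site] [∀ i, Fintype (P i)] [∀ i, DecidableEq (P i)] in
/-- `reg_ginv` in terms of `GFrame₃.DeltaA`. [cite: Balaban1985BackgroundPropagators, Thm 3.3 p.399 + Thm 3.11 p.416] -/
theorem GFrame₃.deltaA_mul_gb {GA : ∀ i, B9.KernelFamily (geo i) (bg i)} {Cinv : ∀ i, B9.SiteKernel (geo i) (bg i)}
    (F : GFrame₃ c35 geo bg Gp b κ S P GA Cinv) (i : I) (α₀ : ℝ) (U : (bg i).Cfg) (hM : F.MInv ≤ (geo i).M) (hα₀ : 0 < α₀)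
    (hMa : (geo i).M * α₀ ≤ F.aInv) (hU : (bg i).Reg335 c35 α₀ U) :
    F.DeltaA i U * F.Gb i U = 1 ∧ F.Gb i U * F.DeltaA i U = 1 :=
  F.reg_ginv i α₀ U hM hα₀ hMa hU

omit [DecidableEq ι] [∀ i, DecidableEq (S i)] [∀ i, Nonempty (geo i).Site] [∀ i, Fintype (P i)] [∀ i, DecidableEq (P i)] in
/-- `gb_eq` in terms of `GFrame₃.DeltaA`: G(V) is the unique two-sided inverse of Δ_a(V). [cite: Balaban1985BackgroundPropagators, (3.30) p.395] -/
theorem GFrame₃.gb_eq_of_inv {GA : ∀ i, B9.KernelFamily (geo i) (bg i)} {Cinv : ∀ i, B9.SiteKernel (geo i) (bg i)}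
    (F : GFrame₃ c35 geo bg Gp b κ S P GA Cinv) (i : I) (V : (bg i).Cfg) (X : Module.End ℝ ((κ × S i) × ι → ℝ))
    (h1 : F.DeltaA i V * X = 1) (h2 : X * F.DeltaA i V = 1) : F.Gb i V = X :=
  F.gb_eq i V _ X rfl h1 h2

/-! ## ★ The (3.42) entries of G(U′U) at the letters, the (3.42)-step and the (3.47)-step -/

/-- **The (3.42) entries of G(U′U) at the letters** — the common core of the (3.42)- and (3.47)-steps for the bond-sector
family: for every input `(B₀, δ₀, B₁, δ₁) > 0` there are `a₁ > 0`, `B ≧ 0` (before the member) such that at every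
(3.35)-regular U above the threshold `Mthr δr` with the (3.42) blocks of `Gp` and `GA` at (B₀, δ₀) and the (3.48) kernel of `Cinv` at
(B₁, δ₁), and every U′ in (3.37) at α₁ ≦ a₁, the family's `G(U′U)` carries the four majorants (entry, left differences, right
differences, Laplacian letter) at `(B, δr/6)`, `δr = min(min(δ₀, δ₁), δcap)`, and inverts the frame's Δ_a(U′U) word
`F.DeltaA i (U′U)` on both sides (the analytic-extension clause) — GIVEN the Lemma-2.1 datum `(d261, h261)` of the module header (v2.1:
rate-dependent exponent).  Proof = r06's `thm34_G_clause_uniform` (R1) at δr and exponent `d261 δr` (all inputs lowered to δr; the (3.48)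
read as a block majorant over the block carrier and lowered to δr; the scale transfers from `hST_of`); `thm34_Gp_uniform` (R1) for the inverse identities of the G′ extension; then three uniqueness identifications —
the family's G′(U′U) IS r06's extension (`gop_eq` ∘ `mul_law`), its C⁻¹(U′U) IS r06's `Tinv` (`cop_eq`, (3.57) `q_mul`), and, after
the section identity `rZero_add_pPrime_sections` and `coord_mul`, its G(U′U) IS r06's `GExt` (`gb_eq`, (3.80) `qb_mul`).
[cite: Balaban1985BackgroundPropagators, Thm 3.4 p.400 + Thm 3.3 p.399 + (3.80)–(3.86) p.407 + (3.68) p.403 + (3.57)–(3.65) p.402 + Thm 3.1 (3.42) p.397 + Thm 3.11 p.416; Balaban1984PropagatorsII, Lemma 2.1 (2.61) p.234] -/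
theorem entries342_ext_of_gFrame₃ {GA : ∀ i, B9.KernelFamily (geo i) (bg i)} {Cinv : ∀ i, B9.SiteKernel (geo i) (bg i)}
    (F : GFrame₃ c35 geo bg Gp b κ S P GA Cinv) (d261 : ℝ → ℕ)
    (h261 : ∀ (i : I) (δ α : ℝ), 0 < δ → δ ≤ F.δcap → 9 / 5000 ≤ α → α < 1 → F.M261 δ ≤ (geo i).M →
      Ineq261 (d261 δ) (toB6 (geo i) (F.Rr i) (F.Hp i)) δ α)
    {B₀ δ₀ B₁ δ₁ : ℝ} (hB₀ : 0 < B₀) (hδ₀ : 0 < δ₀) (hB₁ : 0 < B₁) (hδ₁ : 0 < δ₁) :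
    ∃ a₁ : ℝ, 0 < a₁ ∧ ∃ B : ℝ, 0 ≤ B ∧
      ∀ (i : I) (α₀ : ℝ) (U : (bg i).Cfg), F.Mthr (min (min δ₀ δ₁) F.δcap) ≤ (geo i).M → 0 < α₀ → (geo i).M * α₀ ≤ F.aInv →
        (bg i).Reg335 c35 α₀ U → EBlock (Gp i) B₀ δ₀ U →
        (∀ y y' : (geo i).Site, |(Cinv i).ker U y y'| ≤
          B₁ * ((geo i).len y) ^ (-(4 : ℝ)) * ((geo i).len y') ^ (-(F.dB : ℝ)) * Real.exp (-(δ₁ * (geo i).dist y y'))) →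
        EBlock (GA i) B₀ δ₀ U →
        ∀ (α₁ : ℝ) (U' : (bg i).Cfg), 0 < α₁ → α₁ ≤ a₁ → (bg i).Cplx337 α₁ U U' →
          (F.DeltaA i ((bg i).mul U' U) * F.Gb i ((bg i).mul U' U) = 1 ∧
            F.Gb i ((bg i).mul U' U) * F.DeltaA i ((bg i).mul U' U) = 1) ∧
          HasMajorant (g := toB6 (geo i) (F.Rr i) (F.Hp i)) (fun q : (κ × S i) × ι => F.blk i q.1.2) (F.Gb i ((bg i).mul U' U))
              (fun a a' => B * (geo i).len a ^ 2 * Real.exp (-(min (min δ₀ δ₁) F.δcap / 6 * (geo i).dist a a'))) ∧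
            (∀ k : κ ⊕ κ, HasMajorant (g := toB6 (geo i) (F.Rr i) (F.Hp i)) (fun q : (κ × S i) × ι => F.blk i q.1.2)
              (conj b (diffLetter (bT (F.T i)) (bU (F.coord i U)) ((((geo i).eta : ℂ))⁻¹) k) * F.Gb i ((bg i).mul U' U))
              (fun a a' => B * (geo i).len a * Real.exp (-(min (min δ₀ δ₁) F.δcap / 6 * (geo i).dist a a')))) ∧
            (∀ k : κ ⊕ κ, HasMajorant (g := toB6 (geo i) (F.Rr i) (F.Hp i)) (fun q : (κ × S i) × ι => F.blk i q.1.2)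
              (F.Gb i ((bg i).mul U' U) * conj b (diffLetter (bT (F.T i)) (bU (F.coord i U)) ((((geo i).eta : ℂ))⁻¹) k))
              (fun a a' => B * (geo i).len a * Real.exp (-(min (min δ₀ δ₁) F.δcap / 6 * (geo i).dist a a')))) ∧
            HasMajorant (g := toB6 (geo i) (F.Rr i) (F.Hp i)) (fun q : (κ × S i) × ι => F.blk i q.1.2)
              (F.LapB i U * F.Gb i ((bg i).mul U' U))
              (fun a a' => B * 1 * Real.exp (-(min (min δ₀ δ₁) F.δcap / 6 * (geo i).dist a a'))) := by
  classical
  -- the common rate of the call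
  have hδr : 0 < min (min δ₀ δ₁) F.δcap := lt_min (lt_min hδ₀ hδ₁) F.δcap_pos
  have hδr0 : min (min δ₀ δ₁) F.δcap ≤ δ₀ := le_trans (min_le_left _ _) (min_le_left _ _)
  have hδr1 : min (min δ₀ δ₁) F.δcap ≤ δ₁ := le_trans (min_le_left _ _) (min_le_right _ _)
  have hδrc : min (min δ₀ δ₁) F.δcap ≤ F.δcap := min_le_right _ _
  have hBG : 0 < F.cR * B₀ := mul_pos F.cR_pos hB₀
  have hBb : 0 < F.cRG * B₀ := mul_pos F.cRG_pos hB₀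
  have hBK : 0 < F.cK * B₁ := mul_pos F.cK_pos hB₁
  -- r06's uniform Theorem-3.4 clauses: G′ (for the inverse identities of the extension) and G
  obtain ⟨a₁, ha₁, B', -, H'⟩ := thm34_Gp_uniform b κ (d261 (min (min δ₀ δ₁) F.δcap)) (min (min δ₀ δ₁) F.δcap) (F.cR * B₀) F.Cq F.a₀ F.d₀ F.M₂
    (F.Λf (min (min δ₀ δ₁) F.δcap)) hBG F.Cq_nonneg F.a₀_nonneg F.M₂_nonneg hδr
    (fun α hα => F.Λf_one_le _ α hδr hα) F.hrepr
  obtain ⟨a₂, ha₂, B, hB, H⟩ := thm34_G_clause_uniform_blk b κ (d261 (min (min δ₀ δ₁) F.δcap)) (min (min δ₀ δ₁) F.δcap) (F.cRG * B₀) F.κQ (F.cR * B₀)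
    (F.cK * B₁) F.cF F.Cq F.a₀ F.C₀ F.d₀ F.M₂ F.κQb F.cFb F.abar (F.Λf (min (min δ₀ δ₁) F.δcap)) hBb.le F.κQ_pos hBG hBK
    F.cF_pos F.Cq_nonneg F.a₀_nonneg F.C₀_nonneg F.M₂_nonneg hδr F.κQb_nonneg F.cFb_nonneg F.abar_nonneg
    (fun α hα => F.Λf_one_le _ α hδr hα) F.hrepr
  refine ⟨min a₁ a₂, lt_min ha₁ ha₂, B, hB, ?_⟩
  intro i α₀ U hM0 hα₀ hMa hU hEp hKer hEG α₁ U' hα₁ ha hU'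
  have hM : F.MInv ≤ (geo i).M := F.MInv_le_of_Mthr_le hM0
  have ha1 : α₁ ≤ a₁ := le_trans ha (min_le_left _ _)
  have ha2 : α₁ ≤ a₂ := le_trans ha (min_le_right _ _)
  -- the site-sector letters at U: G′(U) inverts Δ′_a(U); (3.42)₀,₁,₂ of G′ at δ₀ lowered to δr
  obtain ⟨hΔG, hGΔ⟩ := F.reg_inv i α₀ U hM hα₀ hMa hU
  obtain ⟨h1, h2, h3, -⟩ := F.read342 i α₀ U B₀ δ₀ hM hα₀ hMa hU hB₀ hδ₀ hEp
  have hc2 : ∀ a : (geo i).Site, 0 ≤ F.cR * B₀ * (geo i).len a ^ 2 := fun a => mul_nonneg hBG.le (sq_nonneg _)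
  have hc1 : ∀ a : (geo i).Site, 0 ≤ F.cR * B₀ * (geo i).len a := fun a => mul_nonneg hBG.le (F.len_pos i a).le
  have h1' := hasMajorant_rate_le (g := toB6 (geo i) (F.Rr i) (F.Hp i)) (fun p : S i × ι => F.blk i p.1)
    (fun a => (geo i).len a ^ 2) hc2 hδr0 (F.dist_nonneg i) h1
  have h2' := fun k => hasMajorant_rate_le (g := toB6 (geo i) (F.Rr i) (F.Hp i)) (fun p : S i × ι => F.blk i p.1)
    (fun a => (geo i).len a) hc1 hδr0 (F.dist_nonneg i) (h2 k)
  have h3' := fun k => hasMajorant_rate_le (g := toB6 (geo i) (F.Rr i) (F.Hp i)) (fun p : S i × ι => F.blk i p.1)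
    (fun a => (geo i).len a) hc1 hδr0 (F.dist_nonneg i) (h3 k)
  -- the (3.48) kernel of C⁻¹(U) at δ₁, read as a block majorant of the letter over the block carrier, lowered to δr
  have hK := F.readKer i α₀ U B₁ δ₁ hM hα₀ hMa hU hB₁ hδ₁ hKer
  have hK' : HasMajorant (g := toB6 (geo i) (F.Rr i) (F.Hp i)) (F.blkP i) (F.Cop i U)
      (fun a a' => F.cK * B₁ * (geo i).len a ^ (-(4 : ℝ)) * Real.exp (-(min (min δ₀ δ₁) F.δcap * (geo i).dist a a'))) := by
    refine hasMajorant_mono (g := toB6 (geo i) (F.Rr i) (F.Hp i)) (F.blkP i) hK fun a a' => ?_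
    refine mul_le_mul_of_nonneg_left (Real.exp_le_exp.2 ?_) ?_
    · nlinarith [F.dist_nonneg i a a', hδr1]
    · exact mul_nonneg hBK.le (Real.rpow_nonneg (F.len_pos i a).le _)
  -- the bond-sector letters at U: G(U) inverts Δ_a(U); (3.42) of G at δ₀ lowered to δr; (3.15) sizes at δr
  obtain ⟨hΔGb, hGbΔ⟩ := F.reg_ginv i α₀ U hM hα₀ hMa hU
  obtain ⟨g1, g2, g3, -⟩ := F.readG342 i α₀ U B₀ δ₀ hM hα₀ hMa hU hB₀ hδ₀ hEG
  have hb2 : ∀ a : (geo i).Site, 0 ≤ F.cRG * B₀ * (geo i).len a ^ 2 := fun a => mul_nonneg hBb.le (sq_nonneg _)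
  have hb1 : ∀ a : (geo i).Site, 0 ≤ F.cRG * B₀ * (geo i).len a := fun a => mul_nonneg hBb.le (F.len_pos i a).le
  have g1' := hasMajorant_rate_le (g := toB6 (geo i) (F.Rr i) (F.Hp i)) (fun q : (κ × S i) × ι => F.blk i q.1.2)
    (fun a => (geo i).len a ^ 2) hb2 hδr0 (F.dist_nonneg i) g1
  have g2' := fun k => hasMajorant_rate_le (g := toB6 (geo i) (F.Rr i) (F.Hp i)) (fun q : (κ × S i) × ι => F.blk i q.1.2)
    (fun a => (geo i).len a) hb1 hδr0 (F.dist_nonneg i) (g2 k)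
  have g3' := fun k => hasMajorant_rate_le (g := toB6 (geo i) (F.Rr i) (F.Hp i)) (fun q : (κ × S i) × ι => F.blk i q.1.2)
    (fun a => (geo i).len a) hb1 hδr0 (F.dist_nonneg i) (g3 k)
  have hQb := F.hQb i U _ hδr hδrc
  have hQsb := F.hQsb i U _ hδr hδrc
  -- the class (3.37) read blockwise; the (3.57), (3.80)–(3.81) letters; (3.35) on plaquettes
  obtain ⟨hkF, hsF, h337B, h337F, h337Bτ, hA, hAτB⟩ := F.cplx i α₁ U U' hα₁ hU'
  obtain ⟨h337B', h337FB, hAτF, hAFB, hAst, hAloc, hdAst⟩ := F.cplxG i α₁ U U' hα₁ hU'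
  obtain ⟨hQm, hQsm⟩ := F.q_mul i α₁ U U' hα₁ hU'
  obtain ⟨hFc, hFcs⟩ := F.hF i α₁ U U' hα₁ hU'
  obtain ⟨hQbm, hQsbm⟩ := F.qb_mul i α₁ U U' hα₁ hU'
  obtain ⟨hF₂, hF₂s⟩ := F.hF₂ i α₁ U U' hα₁ hU' _ hδr hδrc
  have h35 := F.reg335 i α₀ U hM hα₀ hMa hU
  -- the G′ clause: the inverse identities of the extension ⇒ the family's G′(U′U) is r06's extension
  obtain ⟨hinv1, hinv2, -, -⟩ := H' (F.T i) (F.coord i U) (F.blk i) (F.kQ i U) (F.sQ i U) (F.cfun i) (F.w i U)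
    (F.dist_nonneg i) (F.triangle i) (F.dist_self i) (F.dist_comm i) (F.len_pos i) (F.eta_le_len i) (F.eta_pos i)
    (fun α hα hα1 => h261 i _ α hδr hδrc hα hα1 (F.M261_le_of_Mthr_le hM0)) (F.hST_of i hδr hδrc hM0) (F.unitary i U)
    (F.stencilB i) (F.stencilF i) (F.stencil0 i) (F.w_nonneg i U) (F.card_w i U) (F.hkQ i U) (F.hsQ i U) (F.hcfun i)
    hΔG hGΔ h1' h2' h3' α₁ hα₁.le ha1 (F.expA i U U') (F.kF i U U') (F.sF i U U')
    hkF hsF h337B h337F h337Bτ hA hAτB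
  have hGp := F.gop_eq i ((bg i).mul U' U) _ _ (F.mul_law i α₁ U U' hα₁ hU') hinv1 hinv2
  -- the G clause
  obtain ⟨Tinv, GExt, hT1, hT2, hG1, hG2, hleft, hright⟩ := H (F.T i) (F.coord i U) (F.blk i) (F.kQ i U) (F.sQ i U)
    (F.cfun i) (F.w i U)
    (F.dist_nonneg i) (F.triangle i) (F.dist_self i) (F.dist_comm i) (F.len_pos i) (F.eta_le_len i) (F.eta_pos i)
    (F.L_one_le i) (fun α hα hα1 => h261 i _ α hδr hδrc hα hα1 (F.M261_le_of_Mthr_le hM0)) (F.hST_of i hδr hδrc hM0) (F.T_comm i)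
    (F.unitary i U) h35 (F.stencilB i) (F.stencilF i) (F.stencilFB i) (F.stencilSt i) (F.stencilLoc i) (F.stencil0 i)
    (F.w_nonneg i U) (F.card_w i U) (F.hkQ i U) (F.hsQ i U) (F.hcfun i)
    h1' h2' h3' (F.blkP i) (F.rep i) (F.hrep i) (F.hinj i) (F.hQc i α₀ U hM hα₀ hMa hU) (F.hQcs i α₀ U hM hα₀ hMa hU)
    (F.reg_cinv i α₀ U hM hα₀ hMa hU) hK'
    hQb hQsb (F.ha324 i) hΔGb hGbΔ g1' g2' g3' α₁ hα₁.le ha2 (F.expA i U U') (F.kF i U U') (F.sF i U U')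
    hkF hsF h337B h337F h337B' h337Bτ h337FB hA hAτB hAτF hAFB hAst hAloc hdAst hQm hQsm hFc hFcs hQbm hQsbm rfl hF₂ hF₂s
  -- (1) G′(U′U) = r06's extension; (2) C⁻¹(U′U) = r06's Tinv
  rw [← hGp] at hT1 hT2 hG1 hG2
  have hC := F.cop_eq i ((bg i).mul U' U) _ Tinv rfl hT1 hT2
  rw [← hC] at hG1 hG2
  -- (3) the section identity: R₀ + P′(A) through `rep` is P(U′U) read directly; (4) the background of U′U
  rw [rZero_add_pPrime_sections (F.hinj i), ← F.coord_mul i α₁ U U' hα₁ hU'] at hG1 hG2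
  -- (5) G(U′U) = r06's GExt
  have hGb := F.gb_eq i ((bg i).mul U' U) _ GExt rfl hG1 hG2
  rw [← hGb] at hleft hright hG1 hG2
  -- (6) the four entries of G(U′U) at (B, δr/6)
  have g1'' : HasMajorant (g := toB6 (geo i) (F.Rr i) (F.Hp i)) (fun q : (κ × S i) × ι => F.blk i q.1.2)
      (1 * F.Gb i U)
      (fun a a' => F.cRG * B₀ * (geo i).len a ^ 2 * Real.exp (-(min (min δ₀ δ₁) F.δcap * (geo i).dist a a'))) := by
    rw [one_mul]; exact g1'
  have e0 : HasMajorant (g := toB6 (geo i) (F.Rr i) (F.Hp i)) (fun q : (κ × S i) × ι => F.blk i q.1.2)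
      (1 * F.Gb i ((bg i).mul U' U))
      (fun a a' => B * (geo i).len a ^ 2 * Real.exp (-(min (min δ₀ δ₁) F.δcap / 6 * (geo i).dist a a'))) :=
    hleft 1 (fun a => (geo i).len a ^ 2) (fun a => sq_nonneg _) g1''
  rw [one_mul] at e0
  -- the Laplacian letter entry, read at δ₀ and lowered
  obtain ⟨-, -, -, gL⟩ := F.readG342 i α₀ U B₀ δ₀ hM hα₀ hMa hU hB₀ hδ₀ hEG
  have hb0 : ∀ _a : (geo i).Site, 0 ≤ F.cRG * B₀ * 1 := fun _ => mul_nonneg hBb.le zero_le_one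
  have gL' := hasMajorant_rate_le (g := toB6 (geo i) (F.Rr i) (F.Hp i)) (fun q : (κ × S i) × ι => F.blk i q.1.2)
    (fun _ => (1 : ℝ)) hb0 hδr0 (F.dist_nonneg i) gL
  exact ⟨⟨hG1, hG2⟩, e0, fun k => hleft _ (fun a => (geo i).len a) (fun a => (F.len_pos i a).le) (g2' k),
    fun k => hright _ (g3' k), hleft _ (fun _ => (1 : ℝ)) (fun _ => zero_le_one) gL'⟩

/-- ★ **THE (3.42)-STEP OF SECT. B FOR G(U′U), INHABITED AT THE LETTERS**: every letters dictionary `GFrame₃` for the bond-sector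
family `GA` inhabits the positive-input block-step `B9SectBStepWhole.StepEPos F.dB c35 geo bg Gp GA Cinv GA` (kernel exponent
of the input tuple = the frame's dimension `dB`), by `entries342_ext_of_gFrame₃` and the frame's (3.42) writing, GIVEN the Lemma-2.1 datum
`(d261, h261)` (v2.1, module header).  Thresholds:
M ≧ Mthr δr (v2: invertibility, (2.59), scale transfer), Mα₀ ≦ aInv, α₁ ≦ min(a₁, aW); output constants `(wBG B (δr/6), wδG (δr/6))`,
`δr = min(min(δ₀, δ₁), δcap)`.  Nothing of
print asserted beyond what r06's theorems prove. [cite: Balaban1985BackgroundPropagators, Thm 3.4 p.400 + Thm 3.3 p.399 + (3.80)–(3.86) p.407 + Thm 3.1 (3.42) p.397] -/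
theorem stepEPos_of_gFrame₃ {GA : ∀ i, B9.KernelFamily (geo i) (bg i)} {Cinv : ∀ i, B9.SiteKernel (geo i) (bg i)}
    (F : GFrame₃ c35 geo bg Gp b κ S P GA Cinv) (d261 : ℝ → ℕ)
    (h261 : ∀ (i : I) (δ α : ℝ), 0 < δ → δ ≤ F.δcap → 9 / 5000 ≤ α → α < 1 → F.M261 δ ≤ (geo i).M →
      Ineq261 (d261 δ) (toB6 (geo i) (F.Rr i) (F.Hp i)) δ α) :
    StepEPos F.dB c35 geo bg Gp GA Cinv GA := by
  intro B₀ δ₀ Bβ Bε Bεβ B₁ δ₁ hB₀ hδ₀ hB₁ hδ₁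
  obtain ⟨a₁, ha₁, B, hB, H⟩ := entries342_ext_of_gFrame₃ F d261 h261 hB₀ hδ₀ hB₁ hδ₁
  have hδ6 : 0 < min (min δ₀ δ₁) F.δcap / 6 := by
    have hδr : 0 < min (min δ₀ δ₁) F.δcap := lt_min (lt_min hδ₀ hδ₁) F.δcap_pos
    positivity
  refine ⟨F.Mthr (min (min δ₀ δ₁) F.δcap), min a₁ F.aW, F.aInv,
    (F.wBG B (min (min δ₀ δ₁) F.δcap / 6), F.wδG (min (min δ₀ δ₁) F.δcap / 6)), F.Mthr_pos _, lt_min ha₁ F.aW_pos, F.aInv_pos, ⟨F.wBG_pos B _ hB hδ6, F.wδG_pos _ hδ6⟩, ?_⟩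
  intro i hM α₀ hα₀ hMa U hU hT α₁ hα₁ ha U' hU'
  obtain ⟨-, e0, e1, e2, e3⟩ := H i α₀ U hM hα₀ hMa hU hT.1.1.1 hT.2.1 hT.2.2.1.1 α₁ U' hα₁
    (le_trans ha (min_le_left _ _)) hU'
  exact F.writeG342 i U U' α₁ B _ hα₁ (le_trans ha (min_le_right _ _)) hU' hB hδ6 e0 e1 e2 e3

/-! ## The (3.47) global block of G(U′U) at the letters -/

variable (c35 geo bg Gp b κ S P) in
/-- **THE LETTERS DICTIONARY FOR THE GLOBAL BLOCK (3.47) OF G** — `GFrame₃` plus the writing of the four (3.42)-type majorants of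
`G(U′U)` as the (3.47) block of the family `GA` at U′U (the instance's (3.47)-from-(3.42) reading, p. 398 *"the global
inequalities (3.47) are consequences of the local ones (3.42) and Lemma 2.1"*, at the letters `B9Ineq347AllEntries` on the bond
carrier; writing function `wGG`).  A hypothesis structure; nothing asserted.
[cite: Balaban1985BackgroundPropagators, (3.47) p.398 + Thm 3.3 p.399 + p.407; Balaban1984PropagatorsII, Lemma 2.1 p.234] -/
structure GlobGFrame₃ (GA : ∀ i, B9.KernelFamily (geo i) (bg i)) (Cinv : ∀ i, B9.SiteKernel (geo i) (bg i))
    extends GFrame₃ c35 geo bg Gp b κ S P GA Cinv where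
  wGG : ℝ → ℝ → ℝ
  wGG_pos : ∀ B δ : ℝ, 0 ≤ B → 0 < δ → 0 < wGG B δ
  /-- WRITING (3.47): the four majorants of G(U′U) at (B, δ) ⇒ the (3.47) block of `GA` at U′U with constant `wGG B δ`. -/
  writeGlobG : ∀ i (U U' : (bg i).Cfg) (α₁ B δ : ℝ), 0 < α₁ → α₁ ≤ aW → (bg i).Cplx337 α₁ U U' → 0 ≤ B → 0 < δ →
    HasMajorant (g := toB6 (geo i) (Rr i) (Hp i)) (fun q : (κ × S i) × ι => blk i q.1.2) (Gb i ((bg i).mul U' U))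
        (fun a a' => B * (geo i).len a ^ 2 * Real.exp (-(δ * (geo i).dist a a'))) →
    (∀ k : κ ⊕ κ, HasMajorant (g := toB6 (geo i) (Rr i) (Hp i)) (fun q : (κ × S i) × ι => blk i q.1.2)
        (conj b (diffLetter (bT (T i)) (bU (coord i U)) ((((geo i).eta : ℂ))⁻¹) k) * Gb i ((bg i).mul U' U))
        (fun a a' => B * (geo i).len a * Real.exp (-(δ * (geo i).dist a a')))) →
    (∀ k : κ ⊕ κ, HasMajorant (g := toB6 (geo i) (Rr i) (Hp i)) (fun q : (κ × S i) × ι => blk i q.1.2)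
        (Gb i ((bg i).mul U' U) * conj b (diffLetter (bT (T i)) (bU (coord i U)) ((((geo i).eta : ℂ))⁻¹) k))
        (fun a a' => B * (geo i).len a * Real.exp (-(δ * (geo i).dist a a')))) →
    HasMajorant (g := toB6 (geo i) (Rr i) (Hp i)) (fun q : (κ × S i) × ι => blk i q.1.2)
        (LapB i U * Gb i ((bg i).mul U' U)) (fun a a' => B * 1 * Real.exp (-(δ * (geo i).dist a a'))) →
    B9FromB6.GlobBlock (GA i) (wGG B δ) ((bg i).mul U' U)

/-- ★ **THE (3.47)-STEP OF SECT. B FOR G(U′U), INHABITED AT THE LETTERS**: every `GlobGFrame₃` inhabits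
`B9SectBStepWhole.StepGlobPos F.dB c35 geo bg Gp GA Cinv GA` (output constant `wGG B (δr/6)`), by `entries342_ext_of_gFrame₃` and
the frame's (3.47) writing, GIVEN the Lemma-2.1 datum `(d261, h261)` (v2.1). [cite: Balaban1985BackgroundPropagators, Thm 3.4 p.400 + (3.47) p.398 + Thm 3.3 p.399 + p.407] -/
theorem stepGlobPos_of_globGFrame₃ {GA : ∀ i, B9.KernelFamily (geo i) (bg i)} {Cinv : ∀ i, B9.SiteKernel (geo i) (bg i)}
    (F : GlobGFrame₃ c35 geo bg Gp b κ S P GA Cinv) (d261 : ℝ → ℕ)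
    (h261 : ∀ (i : I) (δ α : ℝ), 0 < δ → δ ≤ F.δcap → 9 / 5000 ≤ α → α < 1 → F.M261 δ ≤ (geo i).M →
      Ineq261 (d261 δ) (toB6 (geo i) (F.Rr i) (F.Hp i)) δ α) :
    B9SectBStepWhole.StepGlobPos F.dB c35 geo bg Gp GA Cinv GA := by
  intro B₀ δ₀ Bβ Bε Bεβ B₁ δ₁ hB₀ hδ₀ hB₁ hδ₁
  obtain ⟨a₁, ha₁, B, hB, H⟩ := entries342_ext_of_gFrame₃ F.toGFrame₃ d261 h261 hB₀ hδ₀ hB₁ hδ₁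
  have hδ6 : 0 < min (min δ₀ δ₁) F.δcap / 6 := by
    have hδr : 0 < min (min δ₀ δ₁) F.δcap := lt_min (lt_min hδ₀ hδ₁) F.δcap_pos
    positivity
  refine ⟨F.Mthr (min (min δ₀ δ₁) F.δcap), min a₁ F.aW, F.aInv, F.wGG B (min (min δ₀ δ₁) F.δcap / 6), F.Mthr_pos _,
    lt_min ha₁ F.aW_pos, F.aInv_pos, F.wGG_pos B _ hB hδ6, ?_⟩
  intro i hM α₀ hα₀ hMa U hU hT α₁ hα₁ ha U' hU'
  obtain ⟨-, e0, e1, e2, e3⟩ := H i α₀ U hM hα₀ hMa hU hT.1.1.1 hT.2.1 hT.2.2.1.1 α₁ U' hα₁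
    (le_trans ha (min_le_left _ _)) hU'
  exact F.writeGlobG i U U' α₁ B _ hα₁ (le_trans ha (min_le_right _ _)) hU' hB hδ6 e0 e1 e2 e3


/-! ## The analytic-extension step for G at the letters (13-An, G half) -/

variable (c35 geo bg Gp b κ S P) in
/-- **THE LETTERS DICTIONARY FOR THE ANALYTIC EXTENSION OF G** — `GFrame₃` plus ONE field: at a (3.35)-regular U above the
thresholds and 0 < α₁ ≦ aW, if the frame's Δ_a(U′U) word `DeltaA i (U′U)` is inverted on both sides by the family's own G(U′U) for
EVERY U′ in the class (3.37) at α₁, then the layer's predicate `IsAnalyticExt i (GA i) U α₁` holds (instance: matrix inverse is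
analytic in A on a finite lattice, cf. `B9Eq386NeumannAnalytic`).  A hypothesis structure; nothing asserted.
[cite: Balaban1985BackgroundPropagators, Thm 3.4 p.400 + (3.84)–(3.86) p.407] -/
structure AnGFrame₃ (GA : ∀ i, B9.KernelFamily (geo i) (bg i)) (Cinv : ∀ i, B9.SiteKernel (geo i) (bg i))
    (IsAnalyticExt : ∀ i, B9.KernelFamily (geo i) (bg i) → (bg i).Cfg → ℝ → Prop)
    extends GFrame₃ c35 geo bg Gp b κ S P GA Cinv where
  writeAnG : ∀ i (α₀ : ℝ) (U : (bg i).Cfg) (α₁ : ℝ), MInv ≤ (geo i).M → 0 < α₀ → (geo i).M * α₀ ≤ aInv →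
    (bg i).Reg335 c35 α₀ U → 0 < α₁ → α₁ ≤ aW →
    (∀ U' : (bg i).Cfg, (bg i).Cplx337 α₁ U U' →
      deltaA (conj b (lapDDLetter (T i) ((((geo i).eta : ℂ))⁻¹) (coord i ((bg i).mul U' U))))
          (conj b (dPrimeLetter (T i) (coord i ((bg i).mul U' U)) (geo i).eta))
          (conjHom b (gradLin (T i) ((((geo i).eta : ℂ))⁻¹) (coord i ((bg i).mul U' U))) ∘ₗ
              (1 - (Gop i ((bg i).mul U' U) ∘ₗ Qcs i ((bg i).mul U' U) ∘ₗ Cop i ((bg i).mul U' U) ∘ₗ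
                Qc i ((bg i).mul U' U) ∘ₗ Gop i ((bg i).mul U' U))) ∘ₗ
            conjHom b (divLin (T i) ((((geo i).eta : ℂ))⁻¹) (coord i ((bg i).mul U' U))))
          (Qsb i ((bg i).mul U' U)) (ab i) (Qb i ((bg i).mul U' U)) * Gb i ((bg i).mul U' U) = 1 ∧
      Gb i ((bg i).mul U' U) *
        deltaA (conj b (lapDDLetter (T i) ((((geo i).eta : ℂ))⁻¹) (coord i ((bg i).mul U' U))))
          (conj b (dPrimeLetter (T i) (coord i ((bg i).mul U' U)) (geo i).eta))
          (conjHom b (gradLin (T i) ((((geo i).eta : ℂ))⁻¹) (coord i ((bg i).mul U' U))) ∘ₗ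
              (1 - (Gop i ((bg i).mul U' U) ∘ₗ Qcs i ((bg i).mul U' U) ∘ₗ Cop i ((bg i).mul U' U) ∘ₗ
                Qc i ((bg i).mul U' U) ∘ₗ Gop i ((bg i).mul U' U))) ∘ₗ
            conjHom b (divLin (T i) ((((geo i).eta : ℂ))⁻¹) (coord i ((bg i).mul U' U))))
          (Qsb i ((bg i).mul U' U)) (ab i) (Qb i ((bg i).mul U' U)) = 1) →
    IsAnalyticExt i (GA i) U α₁

/-- ★ **THE ANALYTIC-EXTENSION STEP OF SECT. B FOR G, INHABITED AT THE LETTERS**: every `AnGFrame₃` inhabits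
`B9SectBStepWhole.StepAnalyticPos1 F.dB c35 geo bg Gp GA Cinv IsAnalyticExt GA` (the G half of `StepAnalyticPos`; the G′ half is
`B9SectBGpStepAtLettersV2.stepAnalyticPos1_of_anFrame₂`, merged by `B9SectBStepWhole.stepAnalyticPos_of_halves`).  Proof: the
inverse identities of `entries342_ext_of_gFrame₃` (GIVEN the Lemma-2.1 datum `(d261, h261)`, v2.1) for every U′ in the class at
α₁ ≦ min(a₁, aW), then `writeAnG`.
[cite: Balaban1985BackgroundPropagators, Thm 3.4 p.400 + (3.84)–(3.86) p.407] -/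
theorem stepAnalyticPos1_of_anGFrame₃ {GA : ∀ i, B9.KernelFamily (geo i) (bg i)} {Cinv : ∀ i, B9.SiteKernel (geo i) (bg i)}
    {IsAnalyticExt : ∀ i, B9.KernelFamily (geo i) (bg i) → (bg i).Cfg → ℝ → Prop}
    (F : AnGFrame₃ c35 geo bg Gp b κ S P GA Cinv IsAnalyticExt) (d261 : ℝ → ℕ)
    (h261 : ∀ (i : I) (δ α : ℝ), 0 < δ → δ ≤ F.δcap → 9 / 5000 ≤ α → α < 1 → F.M261 δ ≤ (geo i).M →
      Ineq261 (d261 δ) (toB6 (geo i) (F.Rr i) (F.Hp i)) δ α) :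
    B9SectBStepWhole.StepAnalyticPos1 F.dB c35 geo bg Gp GA Cinv IsAnalyticExt GA := by
  intro B₀ δ₀ Bβ Bε Bεβ B₁ δ₁ hB₀ hδ₀ hB₁ hδ₁
  obtain ⟨a₁, ha₁, B, -, H⟩ := entries342_ext_of_gFrame₃ F.toGFrame₃ d261 h261 hB₀ hδ₀ hB₁ hδ₁
  refine ⟨F.Mthr (min (min δ₀ δ₁) F.δcap), min a₁ F.aW, F.aInv, PUnit.unit, F.Mthr_pos _, lt_min ha₁ F.aW_pos, F.aInv_pos,
    trivial, ?_⟩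
  intro i hM α₀ hα₀ hMa U hU hT α₁ hα₁ ha
  refine F.writeAnG i α₀ U α₁ (F.MInv_le_of_Mthr_le hM) hα₀ hMa hU hα₁ (le_trans ha (min_le_right _ _)) fun U' hU' => ?_
  exact (H i α₀ U hM hα₀ hMa hU hT.1.1.1 hT.2.1 hT.2.2.1.1 α₁ U' hα₁ (le_trans ha (min_le_left _ _)) hU').1

end Literature.MathematicalPhysics.QuantumFieldTheory.Balaban1983to89.B9SectBGFrameV3
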